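import Summits.ValiantsHypothesis.ValiantsHypothesis.Theorems.FreeSubtorusOrbitDimensionBoundStubDiagonalLiftsSchurian

/-!
# `OrbitDimensionBound` (stmt-ValiantsHypothesis-16133), rung line `square_covering` — stub `stub_stableReduction`,
# infrastructure: the lattice of equal-dimension sub-pencils, and equivariant blocks from a lift-stable sub-pencil

Second helper file toward stub 1 `stub_stableReduction` of `Cruxes/OrbitDimensionBound/Lines/square_covering.lean`
(plan: HOME/lmr/NOTE-p4g12-16133-stableReduction-plan.md, steps I3 and I4).

* `finrank_le_of_subpencil` — for `det M ≠ 0`, every sub-pencil `(V, W)` (each coefficient matrix maps `V` into `W`)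
  has `dim V ≤ dim W` (Frobenius–König, part 1 of `…StubDiagonalLiftsSchurian`);
* `subpencil_sup`, `subpencil_inf`, **`finrank_sup_inf_eq_of_subpencil`** — sub-pencils form a lattice and the
  EQUAL-dimension ones a sublattice (modularity of `dim`);
* block bookkeeping for block upper-triangular matrices (`toBlock_inv_mul_toBlock_eq_one`,
  `toBlock_mul_toBlock_inv_eq_one`, `toBlock_mul_mul_of_upper`, `toBlock_map`) — the pieces of the next step
  «a lift-stable equal-dimension sub-pencil gives a block-triangular split with EQUIVARIANT diagonal blocks»
  and their assembly `block_lifts_of_upper` / `exists_GL_lift_of_block`: «a lift-stable equal-dimension sub-pencil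
  gives a block-triangular split whose two diagonal blocks carry exact lifts of every such substitution»
  (`conj_upper_of_mapsTo`, `inv_mapsTo_of_mapsTo` supply block-triangularity of the conjugated lifts).

Helper mode (`--supports stmt-ValiantsHypothesis-16133 --as helper`).  Honest framing: [folklore] linear algebra toward
ONE registered stub of a dormant rung line whose core `stub_gradedPowerCount` is OPEN; `OrbitDimensionBound`,
`FreeSubtorus` and VP ≠ VNP are OPEN and not moved.

## References
* A. D. King, Quart. J. Math. 45 (1994), §3 (the abelian category of θ-semistable representations) — orientation only.
* [LandsbergRessayre2017] J. M. Landsberg, N. Ressayre, Differential Geom. Appl. 55 (2017), §3.3.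
-/

set_option linter.dupNamespace false

namespace Summit.ValiantsHypothesis.ValiantsHypothesis.Theorems.FreeSubtorusOrbitDimensionBound.SquareCovering

open Matrix MvPolynomial Finset Module.End
open Literature.Computability.AlgebraicComplexity
open Summit.ValiantsHypothesis.ValiantsHypothesis.Theorems.FreeSubtorusConfusionCovering
open Summit.ValiantsHypothesis.ValiantsHypothesis.Theorems.FreeSubtorusOrbitDimensionBound.SignCovering.PerSummand

/-! ### §1 The lattice of sub-pencils -/

section Lattice

variable {σ : Type*} {m : ℕ}

/-- For `det M ≠ 0` a sub-pencil has `dim V ≤ dim W` (Frobenius–König). [folklore] -/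
theorem finrank_le_of_subpencil (M : Matrix (Fin m) (Fin m) (MvPolynomial σ ℂ)) (hM : M.det ≠ 0)
    (V W : Submodule ℂ (Fin m → ℂ))
    (hVW : ∀ (d : σ →₀ ℕ) (x : Fin m → ℂ), x ∈ V → Matrix.toLin' (M.map (coeff d)) x ∈ W) :
    Module.finrank ℂ V ≤ Module.finrank ℂ W := by
  by_contra h
  exact hM (det_eq_zero_of_subpencil M V W hVW (not_le.1 h))

/-- Sub-pencils are closed under sums. [folklore] -/
theorem subpencil_sup (M : Matrix (Fin m) (Fin m) (MvPolynomial σ ℂ)) (V₁ W₁ V₂ W₂ : Submodule ℂ (Fin m → ℂ))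
    (h₁ : ∀ (d : σ →₀ ℕ) (x : Fin m → ℂ), x ∈ V₁ → Matrix.toLin' (M.map (coeff d)) x ∈ W₁)
    (h₂ : ∀ (d : σ →₀ ℕ) (x : Fin m → ℂ), x ∈ V₂ → Matrix.toLin' (M.map (coeff d)) x ∈ W₂) :
    ∀ (d : σ →₀ ℕ) (x : Fin m → ℂ), x ∈ V₁ ⊔ V₂ → Matrix.toLin' (M.map (coeff d)) x ∈ W₁ ⊔ W₂ := by
  intro d x hx
  obtain ⟨y, hy, z, hz, rfl⟩ := Submodule.mem_sup.1 hx
  rw [map_add]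
  exact Submodule.add_mem _ (Submodule.mem_sup_left (h₁ d y hy)) (Submodule.mem_sup_right (h₂ d z hz))

/-- Sub-pencils are closed under intersections. [folklore] -/
theorem subpencil_inf (M : Matrix (Fin m) (Fin m) (MvPolynomial σ ℂ)) (V₁ W₁ V₂ W₂ : Submodule ℂ (Fin m → ℂ))
    (h₁ : ∀ (d : σ →₀ ℕ) (x : Fin m → ℂ), x ∈ V₁ → Matrix.toLin' (M.map (coeff d)) x ∈ W₁)
    (h₂ : ∀ (d : σ →₀ ℕ) (x : Fin m → ℂ), x ∈ V₂ → Matrix.toLin' (M.map (coeff d)) x ∈ W₂) :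
    ∀ (d : σ →₀ ℕ) (x : Fin m → ℂ), x ∈ V₁ ⊓ V₂ → Matrix.toLin' (M.map (coeff d)) x ∈ W₁ ⊓ W₂ := by
  intro d x hx
  exact Submodule.mem_inf.2 ⟨h₁ d x (Submodule.mem_inf.1 hx).1, h₂ d x (Submodule.mem_inf.1 hx).2⟩

/-- **Equal-dimension sub-pencils form a sublattice.**  If `det M ≠ 0` and `(V₁, W₁)`, `(V₂, W₂)` are sub-pencils with
`dim V_i = dim W_i`, then `dim (V₁ + V₂) = dim (W₁ + W₂)` and `dim (V₁ ∩ V₂) = dim (W₁ ∩ W₂)` (modularity of `dim` and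
Frobenius–König for the sum and the intersection). [folklore] -/
theorem finrank_sup_inf_eq_of_subpencil (M : Matrix (Fin m) (Fin m) (MvPolynomial σ ℂ)) (hM : M.det ≠ 0)
    (V₁ W₁ V₂ W₂ : Submodule ℂ (Fin m → ℂ))
    (h₁ : ∀ (d : σ →₀ ℕ) (x : Fin m → ℂ), x ∈ V₁ → Matrix.toLin' (M.map (coeff d)) x ∈ W₁)
    (h₂ : ∀ (d : σ →₀ ℕ) (x : Fin m → ℂ), x ∈ V₂ → Matrix.toLin' (M.map (coeff d)) x ∈ W₂)
    (hd₁ : Module.finrank ℂ V₁ = Module.finrank ℂ W₁) (hd₂ : Module.finrank ℂ V₂ = Module.finrank ℂ W₂) :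
    Module.finrank ℂ ↥(V₁ ⊔ V₂) = Module.finrank ℂ ↥(W₁ ⊔ W₂) ∧
      Module.finrank ℂ ↥(V₁ ⊓ V₂) = Module.finrank ℂ ↥(W₁ ⊓ W₂) := by
  have hs := finrank_le_of_subpencil M hM _ _ (subpencil_sup M V₁ W₁ V₂ W₂ h₁ h₂)
  have hi := finrank_le_of_subpencil M hM _ _ (subpencil_inf M V₁ W₁ V₂ W₂ h₁ h₂)
  have hV := Submodule.finrank_sup_add_finrank_inf_eq V₁ V₂
  have hW := Submodule.finrank_sup_add_finrank_inf_eq W₁ W₂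
  omega

end Lattice

/-! ### §2 Equivariant blocks from a lift-stable sub-pencil -/

section Blocks

variable {σ : Type*} [Fintype σ] [DecidableEq σ] {m : ℕ}

/-- Lower-right block of the inverse of a block upper-triangular invertible matrix. [folklore] -/
theorem toBlock_mul_toBlock_inv_eq_one (X : Matrix (Fin m) (Fin m) ℂ) (p : Fin m → Prop) [DecidablePred p]
    (hX : ∀ i j, ¬ p i → p j → X i j = 0) (hdet : X.det ≠ 0) :
    X.toBlock (fun i => ¬ p i) (fun i => ¬ p i) * X⁻¹.toBlock (fun i => ¬ p i) (fun i => ¬ p i) = 1 := by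
  have h := Matrix.mul_nonsing_inv X (isUnit_iff_ne_zero.2 hdet)
  have h1 := congrArg (fun Y => Y.toBlock (fun i => ¬ p i) (fun i => ¬ p i)) h
  rw [toBlock_mul_eq_add _ p, toBlock_one_self] at h1
  have h0 : X.toBlock (fun i => ¬ p i) p = 0 := by
    ext i j; exact hX i.1 j.1 i.2 j.2
  rwa [h0, Matrix.zero_mul, zero_add] at h1

/-- Upper-left block of the inverse of a block upper-triangular invertible matrix. [folklore] -/
theorem toBlock_inv_mul_toBlock_eq_one (X : Matrix (Fin m) (Fin m) ℂ) (p : Fin m → Prop) [DecidablePred p]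
    (hX : ∀ i j, ¬ p i → p j → X i j = 0) (hdet : X.det ≠ 0) :
    X⁻¹.toBlock p p * X.toBlock p p = 1 := by
  have h := Matrix.nonsing_inv_mul X (isUnit_iff_ne_zero.2 hdet)
  have h1 := congrArg (fun Y => Y.toBlock p p) h
  rw [toBlock_mul_eq_add _ p, toBlock_one_self] at h1
  have h0 : X.toBlock (fun i => ¬ p i) p = 0 := by
    ext i j; exact hX i.1 j.1 i.2 j.2
  rwa [h0, Matrix.mul_zero, add_zero] at h1

/-- Diagonal blocks of a triple product of block upper-triangular matrices (any semiring). [folklore] -/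
theorem toBlock_mul_mul_of_upper {R : Type*} [CommRing R] (X Y Z : Matrix (Fin m) (Fin m) R) (p : Fin m → Prop)
    [DecidablePred p] (hX : ∀ i j, ¬ p i → p j → X i j = 0) (hY : ∀ i j, ¬ p i → p j → Y i j = 0)
    (hZ : ∀ i j, ¬ p i → p j → Z i j = 0) :
    (X * Y * Z).toBlock p p = X.toBlock p p * Y.toBlock p p * Z.toBlock p p ∧
      (X * Y * Z).toBlock (fun i => ¬ p i) (fun i => ¬ p i) =
        X.toBlock (fun i => ¬ p i) (fun i => ¬ p i) * Y.toBlock (fun i => ¬ p i) (fun i => ¬ p i) *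
          Z.toBlock (fun i => ¬ p i) (fun i => ¬ p i) := by
  have hY0 : Y.toBlock (fun i => ¬ p i) p = 0 := by ext i j; exact hY i.1 j.1 i.2 j.2
  have hZ0 : Z.toBlock (fun i => ¬ p i) p = 0 := by ext i j; exact hZ i.1 j.1 i.2 j.2
  have hX0 : X.toBlock (fun i => ¬ p i) p = 0 := by ext i j; exact hX i.1 j.1 i.2 j.2
  have hXY0 : (X * Y).toBlock (fun i => ¬ p i) p = 0 := by
    rw [toBlock_mul_eq_add _ p, hX0, Matrix.zero_mul, zero_add, hY0, Matrix.mul_zero]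
  constructor
  · rw [toBlock_mul_eq_add _ p, hZ0, Matrix.mul_zero, add_zero, toBlock_mul_eq_add _ p, hY0, Matrix.mul_zero,
      add_zero]
  · rw [toBlock_mul_eq_add _ p, hXY0, Matrix.zero_mul, zero_add, toBlock_mul_eq_add _ p, hX0, Matrix.zero_mul,
      zero_add]

/-- Blocks commute with entrywise maps. [folklore] -/
theorem toBlock_map {R S : Type*} (X : Matrix (Fin m) (Fin m) R) (f : R → S) (p q : Fin m → Prop) :
    (X.map f).toBlock p q = (X.toBlock p q).map f := rfl

end Blocks

/-! ### §3 Equivariant diagonal blocks from a lift-stable sub-pencil -/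

section EquivariantBlocks

variable {σ : Type*} [Fintype σ] [DecidableEq σ] {m : ℕ}

/-- In a basis adapted to `S` (first `d` vectors in `S`, coordinates `≥ d` vanish on `S`), an endomorphism preserving
`S` becomes block upper-triangular. [folklore] -/
theorem conj_upper_of_mapsTo (b : Module.Basis (Fin m) ℂ (Fin m → ℂ)) (S : Submodule ℂ (Fin m → ℂ)) (d : ℕ)
    (hbmem : ∀ i : Fin m, (i : ℕ) < d → b i ∈ S) (hb : ∀ x ∈ S, ∀ i : Fin m, d ≤ (i : ℕ) → b.repr x i = 0)
    (G : Matrix (Fin m) (Fin m) ℂ) (hG : ∀ x ∈ S, Matrix.toLin' G x ∈ S) :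
    ∀ i j : Fin m, ¬ (i : ℕ) < d → (j : ℕ) < d →
      (b.toMatrix (Pi.basisFun ℂ (Fin m)) * G * (Pi.basisFun ℂ (Fin m)).toMatrix b) i j = 0 := by
  intro i j hi hj
  rw [toMatrix_mul_mul_toMatrix_apply]
  exact hb _ (hG _ (hbmem j hj)) i (not_lt.1 hi)

/-- An invertible matrix preserving a subspace: its inverse preserves it too. [folklore] -/
theorem inv_mapsTo_of_mapsTo (H : GL (Fin m) ℂ) (S : Submodule ℂ (Fin m → ℂ))
    (hH : ∀ x ∈ S, Matrix.toLin' (H : Matrix (Fin m) (Fin m) ℂ) x ∈ S) :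
    ∀ x ∈ S, Matrix.toLin' ((H⁻¹ : GL (Fin m) ℂ) : Matrix (Fin m) (Fin m) ℂ) x ∈ S := by
  have hinj : Function.Injective (Matrix.toLin' (H : Matrix (Fin m) (Fin m) ℂ)) := by
    intro x y hxy
    have h := congrArg (Matrix.toLin' ((H⁻¹ : GL (Fin m) ℂ) : Matrix (Fin m) (Fin m) ℂ)) hxy
    rwa [← LinearMap.comp_apply, ← LinearMap.comp_apply, ← Matrix.toLin'_mul, ← Units.val_mul, inv_mul_cancel,
      Units.val_one, Matrix.toLin'_one, LinearMap.id_apply, LinearMap.id_apply] at h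
  have hmap : Submodule.map (Matrix.toLin' (H : Matrix (Fin m) (Fin m) ℂ)) S = S := by
    apply Submodule.eq_of_le_of_finrank_eq
    · rintro _ ⟨x, hx, rfl⟩; exact hH x hx
    · exact (Submodule.equivMapOfInjective _ hinj S).finrank_eq.symm
  intro x hx
  rw [← hmap] at hx
  obtain ⟨y, hy, rfl⟩ := hx
  rwa [← LinearMap.comp_apply, ← Matrix.toLin'_mul, ← Units.val_mul, inv_mul_cancel, Units.val_one,
    Matrix.toLin'_one, LinearMap.id_apply]

/-- Substitution commutes with taking blocks and re-indexing. [folklore] -/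
theorem linSubstEntries_toBlock_submatrix {k : ℕ} (γ : GL σ ℂ) (A : Matrix (Fin m) (Fin m) (MvPolynomial σ ℂ))
    (p : Fin m → Prop) (e : {i // p i} ≃ Fin k) :
    Matrix.linSubstEntries γ ((A.toBlock p p).submatrix e.symm e.symm) =
      ((Matrix.linSubstEntries γ A).toBlock p p).submatrix e.symm e.symm := rfl

/-- Packaging a block lift: from `X₁ * Y₁ = 1` (for `H`) and the block equation, an exact lift in `GL`. [folklore] -/
theorem exists_GL_lift_of_block {k : ℕ} (γ : GL σ ℂ) (N : Matrix (Fin k) (Fin k) (MvPolynomial σ ℂ))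
    (G₁ H₁ Hi : Matrix (Fin k) (Fin k) ℂ) (hG : G₁.det ≠ 0) (hHi : Hi * H₁ = 1)
    (h : Matrix.linSubstEntries γ N = G₁.map C * N * Hi.map C) :
    ∃ G H : GL (Fin k) ℂ, Matrix.linSubstEntries γ N =
      (G : Matrix (Fin k) (Fin k) ℂ).map C * N * ((H⁻¹ : GL (Fin k) ℂ) : Matrix (Fin k) (Fin k) ℂ).map C := by
  have hH : H₁.det ≠ 0 := by
    have h1 := congrArg Matrix.det hHi
    rw [Matrix.det_mul, Matrix.det_one] at h1
    exact right_ne_zero_of_mul_eq_one h1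
  refine ⟨Matrix.GeneralLinearGroup.mkOfDetNeZero G₁ hG, Matrix.GeneralLinearGroup.mkOfDetNeZero H₁ hH, ?_⟩
  have hinv : ((Matrix.GeneralLinearGroup.mkOfDetNeZero H₁ hH)⁻¹ : GL (Fin k) ℂ) = (Hi : Matrix (Fin k) (Fin k) ℂ) := by
    rw [Matrix.coe_units_inv, Matrix.GeneralLinearGroup.val_mkOfDetNeZero]
    exact Matrix.inv_eq_left_inv hHi
  rw [hinv, Matrix.GeneralLinearGroup.val_mkOfDetNeZero]
  exact h

/-- **One lift passes to both diagonal blocks.**  `B'`, `G'`, `K` (= the inverse-side factor) block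
upper-triangular for the colouring `p`, `G'`, `K` with two-sided inverses `Gi`, `Ki` which are also block
upper-triangular, and `B'(γ·x) = G' B' K`: then both diagonal blocks of `B'` carry exact lifts of `γ`. [folklore] -/
theorem block_lifts_of_upper {k₁ k₂ : ℕ} (γ : GL σ ℂ) (B' : Matrix (Fin m) (Fin m) (MvPolynomial σ ℂ))
    (G' K Gi Ki : Matrix (Fin m) (Fin m) ℂ) (p : Fin m → Prop) [DecidablePred p]
    (hB' : ∀ i j, ¬ p i → p j → B' i j = 0) (hG' : ∀ i j, ¬ p i → p j → G' i j = 0)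
    (hK : ∀ i j, ¬ p i → p j → K i j = 0) (hGi : ∀ i j, ¬ p i → p j → Gi i j = 0)
    (hKi : ∀ i j, ¬ p i → p j → Ki i j = 0) (hGGi : G' * Gi = 1) (hKiK : Ki * K = 1)
    (hlift : Matrix.linSubstEntries γ B' = G'.map C * B' * K.map C)
    (e₁ : {i // p i} ≃ Fin k₁) (e₂ : {i // ¬ p i} ≃ Fin k₂) :
    (∃ G H : GL (Fin k₁) ℂ, Matrix.linSubstEntries γ ((B'.toBlock p p).submatrix e₁.symm e₁.symm) =
        (G : Matrix (Fin k₁) (Fin k₁) ℂ).map C * (B'.toBlock p p).submatrix e₁.symm e₁.symm *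
          ((H⁻¹ : GL (Fin k₁) ℂ) : Matrix (Fin k₁) (Fin k₁) ℂ).map C) ∧
    (∃ G H : GL (Fin k₂) ℂ,
        Matrix.linSubstEntries γ ((B'.toBlock (fun i => ¬ p i) (fun i => ¬ p i)).submatrix e₂.symm e₂.symm) =
        (G : Matrix (Fin k₂) (Fin k₂) ℂ).map C * (B'.toBlock (fun i => ¬ p i) (fun i => ¬ p i)).submatrix e₂.symm e₂.symm *
          ((H⁻¹ : GL (Fin k₂) ℂ) : Matrix (Fin k₂) (Fin k₂) ℂ).map C) := by
  have hC0 : ∀ (X : Matrix (Fin m) (Fin m) ℂ), (∀ i j, ¬ p i → p j → X i j = 0) →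
      ∀ i j, ¬ p i → p j → (X.map (C (σ := σ))) i j = 0 := fun X hX i j hi hj => by
    rw [Matrix.map_apply, hX i j hi hj, C_0]
  obtain ⟨hb1, hb2⟩ := toBlock_mul_mul_of_upper (G'.map C) B' (K.map C) p (hC0 G' hG') hB' (hC0 K hK)
  rw [← hlift, toBlock_map, toBlock_map] at hb1 hb2
  -- block inverses: upper-left from `Ki * K = 1`, `G' * Gi = 1`; lower-right likewise
  have hGG1 : (G' * Gi).toBlock p p = 1 := by rw [hGGi, toBlock_one_self]
  have hGG2 : (G' * Gi).toBlock (fun i => ¬ p i) (fun i => ¬ p i) = 1 := by rw [hGGi, toBlock_one_self]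
  have hKKi : K * Ki = 1 := mul_eq_one_comm.1 hKiK
  have hKK1 : (K * Ki).toBlock p p = 1 := by rw [hKKi, toBlock_one_self]
  have hKK2 : (K * Ki).toBlock (fun i => ¬ p i) (fun i => ¬ p i) = 1 := by rw [hKKi, toBlock_one_self]
  have hGi0 : Gi.toBlock (fun i => ¬ p i) p = 0 := by ext i j; exact hGi i.1 j.1 i.2 j.2
  have hK0 : K.toBlock (fun i => ¬ p i) p = 0 := by ext i j; exact hK i.1 j.1 i.2 j.2
  have hG'0 : G'.toBlock (fun i => ¬ p i) p = 0 := by ext i j; exact hG' i.1 j.1 i.2 j.2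
  have hKi0 : Ki.toBlock (fun i => ¬ p i) p = 0 := by ext i j; exact hKi i.1 j.1 i.2 j.2
  rw [toBlock_mul_eq_add _ p, hGi0, Matrix.mul_zero, add_zero] at hGG1
  rw [toBlock_mul_eq_add _ p, hG'0, Matrix.zero_mul, zero_add] at hGG2
  rw [toBlock_mul_eq_add _ p, hKi0, Matrix.mul_zero, add_zero] at hKK1
  rw [toBlock_mul_eq_add _ p, hK0, Matrix.zero_mul, zero_add] at hKK2
  constructor
  · refine exists_GL_lift_of_block γ _ ((G'.toBlock p p).submatrix e₁.symm e₁.symm)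
      ((Ki.toBlock p p).submatrix e₁.symm e₁.symm) ((K.toBlock p p).submatrix e₁.symm e₁.symm) ?_ ?_ ?_
    · have h := congrArg Matrix.det hGG1
      rw [Matrix.det_mul, Matrix.det_one] at h
      rw [Matrix.det_submatrix_equiv_self]; exact left_ne_zero_of_mul_eq_one h
    · rw [Matrix.submatrix_mul_equiv, hKK1, Matrix.submatrix_one_equiv]
    · rw [linSubstEntries_toBlock_submatrix, hb1, ← Matrix.submatrix_mul_equiv (e₂ := e₁.symm),
        ← Matrix.submatrix_mul_equiv (e₂ := e₁.symm)]
      rfl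
  · refine exists_GL_lift_of_block γ _ ((G'.toBlock (fun i => ¬ p i) (fun i => ¬ p i)).submatrix e₂.symm e₂.symm)
      ((Ki.toBlock (fun i => ¬ p i) (fun i => ¬ p i)).submatrix e₂.symm e₂.symm)
      ((K.toBlock (fun i => ¬ p i) (fun i => ¬ p i)).submatrix e₂.symm e₂.symm) ?_ ?_ ?_
    · have h := congrArg Matrix.det hGG2
      rw [Matrix.det_mul, Matrix.det_one] at h
      rw [Matrix.det_submatrix_equiv_self]; exact left_ne_zero_of_mul_eq_one h
    · rw [Matrix.submatrix_mul_equiv, hKK2, Matrix.submatrix_one_equiv]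
    · rw [linSubstEntries_toBlock_submatrix, hb2, ← Matrix.submatrix_mul_equiv (e₂ := e₂.symm),
        ← Matrix.submatrix_mul_equiv (e₂ := e₂.symm)]
      rfl

end EquivariantBlocks

end Summit.ValiantsHypothesis.ValiantsHypothesis.Theorems.FreeSubtorusOrbitDimensionBound.SquareCovering
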